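import Summits.BirchSwinnertonDyer.BirchSwinnertonDyer.Theorems.UniversalToricDescentThinCombGroupLikeReflection
import HarnessLib

/-!
# Thin-comb rigidity in PENCIL currency, I: ONE VISIBLE PENCIL (helper on the rational wall `RationalSplitIMCInclusionAtThree`,
# item stmt-BirchSwinnertonDyer-24207, line `ratwall_thin_comb`; cell `pub/bsd-wall`, LEAD `cruxlead-24207` g6;
# `--supports stmt-BirchSwinnertonDyer-24207`)

WHY THIS FILE. The rigidity step of the line (`dvd_pow_mul_of_weakReflection`, Part VII; group-like form
`…GroupLikeReflection`) consumes TWO functional equations (`ρ G ∼ G`, `ρ L₂ ∼ L₂`: card items K4 ⊕ K3(iii), the two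
print-adjacent stubs of skeleton v7) together with ONE rational comb `ThinCombDvdRat G L₂` (K2-rat). Reading the engine
(Parts II–III) prime by prime shows WHAT the functional equations are consumed for: only the prime factors of `G` inside the
comb's bad ideal `(p, T₂)` need them. This file records the two resulting statements in the kernel (ideation memo
`Cruxes/RationalSplitIMCInclusionAtThree/LENS-MEMO-utd-idea-g63.md` §2, «pencil audit», P1/P2):

* §3 **ONE VISIBLE PENCIL ⟹ INTEGRAL DIVISIBILITY, NO REFLECTION** (`dvd_of_thinCombDvdRat_of_not_mem`): if
  `G ∉ (p, T₂)` — i.e. the reduction of `G` to the bottom tooth `T₂ = 0` has `μ = 0` (§2, `mem_span_const_T₂_iff`) —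
  then `ThinCombDvdRat 𝒪 p G F ⟹ G ∣ F`: every prime factor of `G` is visible on every level (Part II
  `not_shape_of_not_mem_span_T₂`), so the core induction (Part III) applies to each, and there is no `p`-power in `G`.
  The slack `p^{t_m}` of the rational comb AND the slack `p^a` of the conclusion both disappear.
* companion file `UniversalToricDescentThinCombTwoPencilRigidity.lean`, **TWO PENCILS ⟹ RIGIDITY**: for a
  constant-fixing automorphism `ρ` with `ρ T₂ ∉ (p, T₂)`, the rational combs of `(G, F)` AND of the transported pair
  `(ρ⁻¹ G, ρ⁻¹ F)` give `G ∣ p^a F` with NO self-symmetry; the symmetric form of Part VII is the special case in which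
  the second pencil is manufactured from the first by the two functional equations (§1 `ThinCombDvdRat.symm_of_dvd`:
  ONE-SIDED divisibilities `G ∣ ρ G`, `ρ F ∣ F` already suffice).
* §4 the one-pencil statement over the receptacle `R₀ = unrIntegers p`, and for the image of a `ℤ_p`-series; §2
  transports the bottom-tooth condition along `ℤ_p → R₀` (`map_map_toUnr_mem_span_iff`), so that it can be asked of the
  `ℤ_p`-characteristic series itself.

READING FOR THE LINE (LEAD census g6): the crux `RationalSplitIMCInclusionAtThree` closes from {toric existence
(♯♯, NO symmetry), K2-rat, `Ch_{Λ₂}(X₂) ⊄ (3, T₂)`} with NO functional equation and an INTEGRAL two-variable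
divisibility `G ∣ L₂` (door `…ClosedModuloBottomMu`, separate file); the two functional-equation stubs of v7 are the
print-adjacent way of killing the bottom-ideal primes instead. Pure commutative algebra; nothing about elliptic curves;
BSD is not proved by any of this.

References: Washington, *Introduction to Cyclotomic Fields*, §7.1–7.2, §13.4 [cite: Washington1997, §7.1–§7.2 and §13.4];
Matsumura, *Commutative Ring Theory*, Thm. 20.3 [cite: Matsumura1987, Thm. 20.3]; Neukirch–Schmidt–Wingberg (5.3.5)
[cite: NeukirchSchmidtWingberg2008, (5.3.5)].
-/

set_option linter.dupNamespace false
set_option autoImplicit false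

noncomputable section

open scoped MatrixGroups
open Literature.NumberTheory.EllipticCurves

namespace Summit.BirchSwinnertonDyer.BirchSwinnertonDyer.Theorems.UniversalToricDescentThinComb.PencilRigidity

open Summit.BirchSwinnertonDyer.Rank1Residual.X11b.Halves

/-! ## §1 Comb divisibility is monotone (divisors on the left, multiples on the right) -/

section Monotone

variable {𝒪 : Type*} [CommRing 𝒪] {p : ℕ}

/-- Comb divisibility passes to a DIVISOR of `G` and a MULTIPLE of `F`: `(G, E_m) ⊆ (G', E_m)` for `G' ∣ G`, and ideals are
closed under multiplication. In particular it is invariant under units on both sides. [cite: Washington1997, §7.1] -/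
theorem ThinCombDvdRat.of_dvd_of_dvd {G G' F F' : PowerSeries (PowerSeries 𝒪)} (h : ThinCombDvdRat 𝒪 p G F)
    (hG : G' ∣ G) (hF : F ∣ F') : ThinCombDvdRat 𝒪 p G' F' := by
  intro n
  obtain ⟨m, hnm, t, hmem⟩ := h n
  obtain ⟨c, rfl⟩ := hG
  obtain ⟨d, rfl⟩ := hF
  obtain ⟨a, b, hab⟩ := Ideal.mem_span_pair.mp hmem
  exact ⟨m, hnm, t, Ideal.mem_span_pair.mpr ⟨a * c * d, b * d, by rw [← mul_assoc, ← hab]; ring⟩⟩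

/-- Integral comb divisibility passes to a divisor of `G` and a multiple of `F`. [cite: Washington1997, §7.1] -/
theorem ThinCombDvdInt.of_dvd_of_dvd {G G' F F' : PowerSeries (PowerSeries 𝒪)} (h : ThinCombDvdInt 𝒪 p G F)
    (hG : G' ∣ G) (hF : F ∣ F') : ThinCombDvdInt 𝒪 p G' F' := by
  intro n
  obtain ⟨m, hnm, hmem⟩ := h n
  obtain ⟨c, rfl⟩ := hG
  obtain ⟨d, rfl⟩ := hF
  obtain ⟨a, b, hab⟩ := Ideal.mem_span_pair.mp hmem
  exact ⟨m, hnm, Ideal.mem_span_pair.mpr ⟨a * c * d, b * d, by rw [← hab]; ring⟩⟩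

/-- Comb divisibility is invariant under associates on both sides. [cite: Washington1997, §7.1] -/
theorem ThinCombDvdRat.of_associated {G G' F F' : PowerSeries (PowerSeries 𝒪)} (h : ThinCombDvdRat 𝒪 p G F)
    (hG : Associated G G') (hF : Associated F F') : ThinCombDvdRat 𝒪 p G' F' :=
  ThinCombDvdRat.of_dvd_of_dvd h hG.symm.dvd hF.dvd

/-- Integral comb divisibility is invariant under associates on both sides. [cite: Washington1997, §7.1] -/
theorem ThinCombDvdInt.of_associated {G G' F F' : PowerSeries (PowerSeries 𝒪)} (h : ThinCombDvdInt 𝒪 p G F)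
    (hG : Associated G G') (hF : Associated F F') : ThinCombDvdInt 𝒪 p G' F' :=
  ThinCombDvdInt.of_dvd_of_dvd h hG.symm.dvd hF.dvd

/-- An integral comb is a rational comb (slack `t = 0`). [cite: Washington1997, §7.1] -/
theorem ThinCombDvdInt.thinCombDvdRat {G F : PowerSeries (PowerSeries 𝒪)} (h : ThinCombDvdInt 𝒪 p G F) :
    ThinCombDvdRat 𝒪 p G F := fun n => by
  obtain ⟨m, hnm, hmem⟩ := h n
  exact ⟨m, hnm, 0, by rwa [pow_zero, map_one, one_mul]⟩

/-- **The second pencil from ONE-SIDED functional equations.** If `G ∣ ρ G` and `ρ F ∣ F` for a ring automorphism `ρ`,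
the comb of `(G, F)` is also a comb of the transported pair `(ρ⁻¹ G, ρ⁻¹ F)` (`ρ⁻¹ G ∣ G`, `F ∣ ρ⁻¹ F`). For an involutive
`ρ` these one-sided divisibilities are equivalent to `ρ G ∼ G`, `ρ F ∼ F` (`…ThinComb.InvolutiveReflection`).
[cite: Washington1997, §13.4] -/
theorem ThinCombDvdRat.symm_of_dvd {G F : PowerSeries (PowerSeries 𝒪)} (h : ThinCombDvdRat 𝒪 p G F)
    (ρ : PowerSeries (PowerSeries 𝒪) ≃+* PowerSeries (PowerSeries 𝒪)) (hG : G ∣ ρ G) (hF : ρ F ∣ F) :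
    ThinCombDvdRat 𝒪 p (ρ.symm G) (ρ.symm F) := by
  refine ThinCombDvdRat.of_dvd_of_dvd h ?_ ?_
  · have := map_dvd (ρ.symm : PowerSeries (PowerSeries 𝒪) →+* PowerSeries (PowerSeries 𝒪)) hG
    rwa [RingHom.coe_coe, RingEquiv.symm_apply_apply] at this
  · have := map_dvd (ρ.symm : PowerSeries (PowerSeries 𝒪) →+* PowerSeries (PowerSeries 𝒪)) hF
    rwa [RingHom.coe_coe, RingEquiv.symm_apply_apply] at this

/-- The second pencil from the symmetric (two-sided) functional equations `ρ G ∼ G`, `ρ F ∼ F`.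
[cite: Washington1997, §13.4] -/
theorem ThinCombDvdRat.symm_of_associated {G F : PowerSeries (PowerSeries 𝒪)} (h : ThinCombDvdRat 𝒪 p G F)
    (ρ : PowerSeries (PowerSeries 𝒪) ≃+* PowerSeries (PowerSeries 𝒪)) (hG : Associated (ρ G) G)
    (hF : Associated (ρ F) F) : ThinCombDvdRat 𝒪 p (ρ.symm G) (ρ.symm F) :=
  ThinCombDvdRat.symm_of_dvd h ρ hG.symm.dvd hF.dvd

end Monotone

/-! ## §2 The bottom tooth: membership in `(p, T₂)` coefficientwise, and its transport along `ℤ_p → R₀` -/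

section Bottom

variable (𝒪 : Type*) [CommRing 𝒪] (p : ℕ)

/-- **`Q ∈ (p, T₂)` iff every `T₁`-coefficient of `Q` has constant term (in `T₂`) divisible by `p`** — i.e. iff the
reduction of `Q` to the bottom tooth `T₂ = 0` read modulo `p` (in `(𝒪/p)⟦T₁⟧`) vanishes: `μ > 0` on the bottom tooth.
[cite: Washington1997, §7.1] -/
theorem mem_span_const_T₂_iff (Q : PowerSeries (PowerSeries 𝒪)) :
    Q ∈ Ideal.span {const 𝒪 (p : 𝒪), T₂ 𝒪} ↔
      ∀ i : ℕ, (p : 𝒪) ∣ PowerSeries.constantCoeff (PowerSeries.coeff i Q) := by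
  constructor
  · intro h i
    obtain ⟨a, b, hab⟩ := Ideal.mem_span_pair.mp h
    rw [← hab, map_add, show const 𝒪 (p : 𝒪) = PowerSeries.C (PowerSeries.C (p : 𝒪)) from rfl, T₂,
      PowerSeries.coeff_mul_C, PowerSeries.coeff_mul_C, map_add, map_mul, map_mul, PowerSeries.constantCoeff_C,
      PowerSeries.constantCoeff_X, mul_zero, add_zero]
    exact Dvd.intro_left _ rfl
  · intro h
    apply mem_span_const_T₂_of_map_eq_zero 𝒪 p
    ext i
    rw [PowerSeries.coeff_map, RingHom.comp_apply, map_zero, Ideal.Quotient.eq_zero_iff_mem,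
      Ideal.mem_span_singleton]
    exact h i

variable {𝒪 p} in
/-- Ideal membership in `(p, T₂)` is inherited by multiples (used prime by prime: a prime factor of `G ∉ (p, T₂)` is
itself `∉ (p, T₂)`). [cite: Washington1997, §7.1] -/
theorem not_mem_span_const_T₂_of_dvd {P G : PowerSeries (PowerSeries 𝒪)} (hPG : P ∣ G)
    (hG : G ∉ Ideal.span {const 𝒪 (p : 𝒪), T₂ 𝒪}) : P ∉ Ideal.span {const 𝒪 (p : 𝒪), T₂ 𝒪} := by
  obtain ⟨c, rfl⟩ := hPG
  exact fun h => hG (Ideal.mul_mem_right _ _ h)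

/-- `p ∣ toUnr x` in `R₀ = unrIntegers p` iff `p ∣ x` in `ℤ_p` (the structure map `ℤ_p → R₀` is isometric, and in both
rings divisibility by `p` means norm `< 1`). [cite: SerreLocalFields1979, Ch. II §5, Thm. 3] -/
theorem natCast_dvd_toUnr_iff [Fact p.Prime] (x : ℤ_[p]) :
    ((p : ℕ) : unrIntegers p) ∣ toUnr p x ↔ (p : ℤ_[p]) ∣ x := by
  letI := Summit.BirchSwinnertonDyer.Rank1Residual.X2.HidaLimitAlgebra.isDiscreteValuationRing_unrIntegers (p := p)
  have hnorm : ‖((toUnr p x : unrIntegers p) : ℂ_[p])‖ = ‖x‖ := by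
    rw [coe_toUnr, norm_algebraMap', PadicInt.norm_def]
  rw [← Ideal.mem_span_singleton, ← GroupLikeReflection.maximalIdeal_unrIntegers_eq p, IsLocalRing.mem_maximalIdeal,
    mem_nonunits_iff, unrIntegers.isUnit_iff_norm_eq_one, hnorm, ← Ideal.mem_span_singleton,
    ← PadicInt.maximalIdeal_eq_span_p, IsLocalRing.mem_maximalIdeal, mem_nonunits_iff, PadicInt.isUnit_iff]

/-- **Transport of the bottom-tooth condition along `ℤ_p → R₀`**: for `g ∈ ℤ_p⟦T₂⟧⟦T₁⟧`, its image in `R₀⟦T₂⟧⟦T₁⟧` lies in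
`(p, T₂)` iff `g ∈ (p, T₂)` (coefficientwise, `natCast_dvd_toUnr_iff`). [cite: Washington1997, §7.1] -/
theorem map_map_toUnr_mem_span_iff [Fact p.Prime] (g : PowerSeries (PowerSeries ℤ_[p])) :
    PowerSeries.map (PowerSeries.map (toUnr p)) g ∈
        Ideal.span {const (unrIntegers p) ((p : ℕ) : unrIntegers p), T₂ (unrIntegers p)} ↔
      g ∈ Ideal.span {const ℤ_[p] (p : ℤ_[p]), T₂ ℤ_[p]} := by
  rw [show (((p : ℕ) : unrIntegers p)) = ((p : ℕ) : unrIntegers p) from rfl, mem_span_const_T₂_iff,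
    mem_span_const_T₂_iff]
  refine forall_congr' fun i => ?_
  rw [PowerSeries.coeff_map, ← PowerSeries.coeff_zero_eq_constantCoeff_apply, PowerSeries.coeff_map,
    PowerSeries.coeff_zero_eq_constantCoeff_apply]
  exact natCast_dvd_toUnr_iff p _

/-- The bottom-tooth condition is also NECESSARY for slack-free rigidity from one pencil: `G = T₂` has the rational (even
integral) comb with `F = 1` (`RatCombTightness.thinCombDvdRat_T₂_one`) but `T₂ ∤ 1`; and `T₂ ∈ (p, T₂)`. Recorded as the
membership fact. [cite: Washington1997, §7.1] -/
theorem T₂_mem_span_const_T₂ : T₂ 𝒪 ∈ Ideal.span {const 𝒪 (p : 𝒪), T₂ 𝒪} :=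
  Ideal.subset_span (by simp)

end Bottom

/-! ## §3 ONE visible pencil: `G ∉ (p, T₂)` and `ThinCombDvdRat G F` give `G ∣ F` — no reflection, no slack -/

section OnePencil

variable (𝒪 : Type*) [CommRing 𝒪] [IsDomain 𝒪] [IsDiscreteValuationRing 𝒪] (p : ℕ) [hp : Fact p.Prime]

/-- **ONE VISIBLE PENCIL ⟹ INTEGRAL DIVISIBILITY (P1 of the pencil audit).** For every DVR `𝒪` with maximal ideal `(p)`:
if `G ∉ (p, T₂)` (the bottom-tooth reduction of `G` has `μ = 0`) and `G ∣ p^{t_m}·F (mod E_m(T₂))` on comb levels of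
unbounded order, then `G ∣ F` in `𝒪⟦T₂⟧⟦T₁⟧`. Proof: `p ∤ G` and every prime factor `P` of `G` lies outside `(p, T₂)`,
hence is VISIBLE on every level (Part II `not_shape_of_not_mem_span_T₂`); the core induction (Part III
`pow_dvd_of_visible_levels`) gives `P^k ∣ F` for each prime power `P^k ∥ G`, and `Λ₂(𝒪)` is factorial. NO functional
equation is used and the conclusion has NO `p`-power slack. [cite: Washington1997, §7.1–§7.2; Matsumura1987, Thm. 20.3] -/
theorem dvd_of_thinCombDvdRat_of_not_mem (hmax : IsLocalRing.maximalIdeal 𝒪 = Ideal.span {(p : 𝒪)})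
    {G F : PowerSeries (PowerSeries 𝒪)} (hG : G ∉ Ideal.span {const 𝒪 (p : 𝒪), T₂ 𝒪})
    (hcomb : ThinCombDvdRat 𝒪 p G F) : G ∣ F := by
  classical
  obtain ⟨hp0, hpu, hprime, hpprime⟩ := p_ne_zero_of_maximalIdeal_eq 𝒪 p hmax
  haveI := Literature.NumberTheory.IwasawaTheory.uniqueFactorizationMonoid_powerSeries_powerSeries 𝒪
  have hcp : Prime (const 𝒪 (p : 𝒪)) :=
    Literature.NumberTheory.EllipticCurves.prime_C_of_prime (Literature.NumberTheory.EllipticCurves.prime_C_of_prime hpprime)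
  have hG0 : G ≠ 0 := by rintro rfl; exact hG (Ideal.zero_mem _)
  -- levels for every divisor of `G`
  have hlevD : ∀ D, D ∣ G → ∀ n : ℕ, ∃ m : ℕ, n ≤ m ∧
      ∃ t : ℕ, const 𝒪 ((p : 𝒪) ^ t) * F ∈ Ideal.span {D, combElt 𝒪 p m} := by
    rintro D ⟨c, rfl⟩ n
    obtain ⟨m, hnm, t, hmem⟩ := hcomb n
    obtain ⟨a, b, hab⟩ := Ideal.mem_span_pair.mp hmem
    exact ⟨m, hnm, t, Ideal.mem_span_pair.mpr ⟨a * c, b, by rw [← hab]; ring⟩⟩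
  refine UniqueFactorizationMonoid.induction_on_coprime (P := fun D => D ∣ G → D ∣ F) G ?_ ?_ ?_ ?_ dvd_rfl
  · intro h; exact absurd (zero_dvd_iff.mp h) hG0
  · intro x hx _; exact hx.dvd
  · intro P k hP hPk
    rcases k with _ | k
    · simp
    have hPG : P ∣ G := (dvd_pow_self P (Nat.succ_ne_zero k)).trans hPk
    -- `P ∉ (p, T₂)`, in particular `P ≁ p`
    have hP2 : P ∉ Ideal.span {const 𝒪 (p : 𝒪), T₂ 𝒪} := not_mem_span_const_T₂_of_dvd hPG hG
    have hPp : ¬ P ∣ const 𝒪 (p : 𝒪) := fun h =>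
      hP2 ((hP.irreducible.associated_of_dvd hcp.irreducible h).symm.dvd.elim fun c hc => by
        rw [hc]; exact Ideal.mul_mem_right _ _ (Ideal.subset_span (by simp)))
    refine pow_dvd_of_visible_levels 𝒪 p hmax hP hPp (k + 1) F (levels_avoiding 𝒪 p hPp fun n => ?_)
    obtain ⟨m, hnm, hmem⟩ := hlevD _ hPk n
    exact ⟨m, hnm, visible_of_not_shape 𝒪 p hmax m (not_shape_of_not_mem_span_T₂ 𝒪 p m hmax hP2 hP.not_unit),
      hmem⟩
  · intro x y hxy hx hy hdvd
    exact hxy.mul_dvd (hx (dvd_of_mul_right_dvd hdvd)) (hy (dvd_of_mul_left_dvd hdvd))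

end OnePencil

/-! ## §4 The receptacle `R₀ = unrIntegers p` -/

section Unr

variable (p : ℕ) [hp : Fact p.Prime]

/-- **One visible pencil over `R₀ = unrIntegers p`** (the line's receptacle): `G ∉ (p, T₂)` and `ThinCombDvdRat R₀ p G F`
give `G ∣ F`. [cite: Washington1997, §7.1–§7.2; Matsumura1987, Thm. 20.3] -/
theorem dvd_of_thinCombDvdRat_of_not_mem_unr {G F : PowerSeries (UnrSeries p)}
    (hG : G ∉ Ideal.span {const (unrIntegers p) ((p : ℕ) : unrIntegers p), T₂ (unrIntegers p)})
    (hcomb : ThinCombDvdRat (unrIntegers p) p G F) : G ∣ F := by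
  letI := Summit.BirchSwinnertonDyer.Rank1Residual.X2.HidaLimitAlgebra.isDiscreteValuationRing_unrIntegers (p := p)
  exact dvd_of_thinCombDvdRat_of_not_mem (unrIntegers p) p (GroupLikeReflection.maximalIdeal_unrIntegers_eq p) hG hcomb

/-- **One visible pencil over `R₀` for the image of a `ℤ_p`-series**: if `g ∈ ℤ_p⟦T₂⟧⟦T₁⟧` is NOT in `(p, T₂)` (its
bottom-tooth reduction has `μ = 0`) and `F ∈ R₀⟦T₂⟧⟦T₁⟧` is rationally comb-divisible by the image `G` of `g`, then `G ∣ F`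
— the form consumed by the door `…ClosedModuloBottomMu` of the rational wall. [cite: Washington1997, §7.1–§7.2; Matsumura1987, Thm. 20.3] -/
theorem map_map_toUnr_dvd_of_thinCombDvdRat_of_not_mem {g : PowerSeries (PowerSeries ℤ_[p])}
    (hg : g ∉ Ideal.span {const ℤ_[p] (p : ℤ_[p]), T₂ ℤ_[p]}) {F : PowerSeries (UnrSeries p)}
    (hcomb : ThinCombDvdRat (unrIntegers p) p (PowerSeries.map (PowerSeries.map (toUnr p)) g) F) :
    PowerSeries.map (PowerSeries.map (toUnr p)) g ∣ F :=
  dvd_of_thinCombDvdRat_of_not_mem_unr p (fun h => hg ((map_map_toUnr_mem_span_iff p g).mp h)) hcomb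

end Unr

end Summit.BirchSwinnertonDyer.BirchSwinnertonDyer.Theorems.UniversalToricDescentThinComb.PencilRigidity

end
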